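import Summits.CriticalPhenomena.PercolationContinuityZ3.Theorems.Transplant.FKConnectivityAllQPat3CornerP11Star
import Summits.CriticalPhenomena.PercolationContinuityZ3.Theorems.Transplant.FKConnectivityAllQPat3CornerP11StarM
import HarnessLib

/-!
# Connectivity correlation inequalities for `φ_{w,q}`, every `q > 0` — THE CORNER LEAF LEMMAS OVER `famP11` (census g39 §4 certificates
# `…Pat3CornerP11{Tsym,Star,StarM}.lean` plugged into `FK.shape2C_nonneg_of_rows`; census g40)

Theorems file (`--supports stmt-CriticalPhenomena-4575`), census lineage (gen 40) of LANE 2's FK sub-programme; builds on p205010 (kernel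
theorem, internal audit signed; external expert review pending).  No named facts, no sorries; standard axioms.

SETTING: names `p : Fin 4 → V`, poles `p 0, p 1`, the mark `x` AT the pole `p 0`, two piece minors glued at `(p 0, p 1)` with inner
marks `y = p 2`, `s = p 3`; no plain edges (`FK.cornerPSkel = []`).
* `FK.cornerP11_tsym_level_nonneg`, `FK.cornerP11_starX_level_nonneg`, `FK.cornerP11_starXm_level_nonneg` (`mirror2 STAR_x`).
[cite: AyyerLinussonRavichandran2025, §7 (p. 22)]
-/

namespace Summit.CriticalPhenomena.PercolationContinuityZ3.Theorems

namespace FK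

open SimpleGraph Literature.Probability.LatticeModels Literature.Probability.Percolation
open scoped Classical

variable {V : Type*}
/-! ### THE CORNER LEAF LEMMAS OVER famP11 (census g39 §4): certificates plugged into `FK.shape2C_nonneg_of_rows` -/

section CornerLeaf

/-- Empty skeleton: nothing to check. [folklore] -/
theorem cornerPSkel_ne {p : Fin 4 → V} : ∀ e ∈ cornerPSkel, p e.1 ≠ p e.2 := by
  intro e he; simp [cornerPSkel] at he

/-- Empty skeleton: nothing to check. [folklore] -/
theorem cornerPSkel_nodup {p : Fin 4 → V} : (cornerPSkel.map (pedge p)).Nodup := by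
  simp [cornerPSkel]

/-- Empty skeleton: nothing to check. [folklore] -/
theorem cornerPSkel_marks {p : Fin 4 → V} : ∀ e ∈ cornerPSkel, (p e.1 ≠ p 2 ∧ p e.2 ≠ p 2) ∧ (p e.1 ≠ p 3 ∧ p e.2 ≠ p 3) := by
  intro e he; simp [cornerPSkel] at he

variable [Fintype V] {p : Fin 4 → V} {E₁ C₁ E₂ C₂ : Finset (Sym2 V)} {V₁ V₂ : Set V}

/-- **LEAF CORNER (famP11) × T_sym** (kernel certificate `FK.cornerP_tsym_rows`): two piece minors `(E₁, C₁)`, `(E₂, C₂)` glued along `(p 0, p 1)` with inner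
marks `p 2, p 3`, each carrying `famP11` levelwise nonnegative at its `(u, v, m)`; the target is levelwise nonnegative at
`(p 0, p 2, p 3)` (`x` AT the pole `p 0`) on the composite minor. [cite: AyyerLinussonRavichandran2025, §7 (p. 22)] -/
theorem cornerP11_tsym_level_nonneg (hinj : Function.Injective p)
    (hE1 : ∀ e ∈ (↑(E₁ ∪ C₁) : Set (Sym2 V)), ∀ z ∈ e, z ∈ V₁) (hE2 : ∀ e ∈ (↑(E₂ ∪ C₂) : Set (Sym2 V)), ∀ z ∈ e, z ∈ V₂)
    (hp1 : ∀ a, p a ∈ V₁ → p a = p 0 ∨ p a = p 1 ∨ p a = p 2) (hp2 : ∀ a, p a ∈ V₂ → p a = p 0 ∨ p a = p 1 ∨ p a = p 3)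
    (h12 : ∀ z ∈ V₁, z ∈ V₂ → z = p 0 ∨ z = p 1) (hm1 : p 2 ∈ V₁) (hm2 : p 3 ∈ V₂)
    (hd1 : Disjoint (plainSet p cornerPSkel) E₁) (hd2 : Disjoint (plainSet p cornerPSkel ∪ E₁) E₂)
    (hval1 : ∀ i ν, 0 ≤ lev2C E₁ C₁ (p 0) (p 1) (p 2) (famGet famP11 i) ν)
    (hval2 : ∀ i ν, 0 ≤ lev2C E₂ C₂ (p 0) (p 1) (p 3) (famGet famP11 i) ν) (μ : ℕ) :
    0 ≤ lev2C (plainSet p cornerPSkel ∪ E₁ ∪ E₂) (C₁ ∪ C₂) (p 0) (p 2) (p 3) tsym2Tab μ :=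
  shape2C_nonneg_of_rows hinj hE1 hE2 hp1 hp2 h12 hm1 hm2 (hinj.ne (by decide)) (hinj.ne (by decide)) rfl rfl rfl rfl rfl rfl
    (by decide) (by decide) rfl rfl rfl cornerPSkel_ne cornerPSkel_nodup cornerPSkel_marks hd1 hd2 tsym2Tab (by norm_num)
    cornerP_tsym_rows (Prod2.ofIdx_nonneg (famGet_famP11orb_nonneg hval1) (famGet_famP11orb_nonneg hval2)) μ

/-- **LEAF CORNER (famP11) × STAR_x** (kernel certificate `FK.cornerP_starX_rows`): two piece minors `(E₁, C₁)`, `(E₂, C₂)` glued along `(p 0, p 1)` with inner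
marks `p 2, p 3`, each carrying `famP11` levelwise nonnegative at its `(u, v, m)`; the target is levelwise nonnegative at
`(p 0, p 2, p 3)` (`x` AT the pole `p 0`) on the composite minor. [cite: AyyerLinussonRavichandran2025, §7 (p. 22)] -/
theorem cornerP11_starX_level_nonneg (hinj : Function.Injective p)
    (hE1 : ∀ e ∈ (↑(E₁ ∪ C₁) : Set (Sym2 V)), ∀ z ∈ e, z ∈ V₁) (hE2 : ∀ e ∈ (↑(E₂ ∪ C₂) : Set (Sym2 V)), ∀ z ∈ e, z ∈ V₂)
    (hp1 : ∀ a, p a ∈ V₁ → p a = p 0 ∨ p a = p 1 ∨ p a = p 2) (hp2 : ∀ a, p a ∈ V₂ → p a = p 0 ∨ p a = p 1 ∨ p a = p 3)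
    (h12 : ∀ z ∈ V₁, z ∈ V₂ → z = p 0 ∨ z = p 1) (hm1 : p 2 ∈ V₁) (hm2 : p 3 ∈ V₂)
    (hd1 : Disjoint (plainSet p cornerPSkel) E₁) (hd2 : Disjoint (plainSet p cornerPSkel ∪ E₁) E₂)
    (hval1 : ∀ i ν, 0 ≤ lev2C E₁ C₁ (p 0) (p 1) (p 2) (famGet famP11 i) ν)
    (hval2 : ∀ i ν, 0 ≤ lev2C E₂ C₂ (p 0) (p 1) (p 3) (famGet famP11 i) ν) (μ : ℕ) :
    0 ≤ lev2C (plainSet p cornerPSkel ∪ E₁ ∪ E₂) (C₁ ∪ C₂) (p 0) (p 2) (p 3) starXTab μ :=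
  shape2C_nonneg_of_rows hinj hE1 hE2 hp1 hp2 h12 hm1 hm2 (hinj.ne (by decide)) (hinj.ne (by decide)) rfl rfl rfl rfl rfl rfl
    (by decide) (by decide) rfl rfl rfl cornerPSkel_ne cornerPSkel_nodup cornerPSkel_marks hd1 hd2 starXTab (by norm_num)
    cornerP_starX_rows (Prod2.ofIdx_nonneg (famGet_famP11orb_nonneg hval1) (famGet_famP11orb_nonneg hval2)) μ

/-- **LEAF CORNER (famP11) × mirror2 STAR_x** (kernel certificate `FK.cornerP_starXm_rows`): two piece minors `(E₁, C₁)`, `(E₂, C₂)` glued along `(p 0, p 1)` with inner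
marks `p 2, p 3`, each carrying `famP11` levelwise nonnegative at its `(u, v, m)`; the target is levelwise nonnegative at
`(p 0, p 2, p 3)` (`x` AT the pole `p 0`) on the composite minor. [cite: AyyerLinussonRavichandran2025, §7 (p. 22)] -/
theorem cornerP11_starXm_level_nonneg (hinj : Function.Injective p)
    (hE1 : ∀ e ∈ (↑(E₁ ∪ C₁) : Set (Sym2 V)), ∀ z ∈ e, z ∈ V₁) (hE2 : ∀ e ∈ (↑(E₂ ∪ C₂) : Set (Sym2 V)), ∀ z ∈ e, z ∈ V₂)
    (hp1 : ∀ a, p a ∈ V₁ → p a = p 0 ∨ p a = p 1 ∨ p a = p 2) (hp2 : ∀ a, p a ∈ V₂ → p a = p 0 ∨ p a = p 1 ∨ p a = p 3)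
    (h12 : ∀ z ∈ V₁, z ∈ V₂ → z = p 0 ∨ z = p 1) (hm1 : p 2 ∈ V₁) (hm2 : p 3 ∈ V₂)
    (hd1 : Disjoint (plainSet p cornerPSkel) E₁) (hd2 : Disjoint (plainSet p cornerPSkel ∪ E₁) E₂)
    (hval1 : ∀ i ν, 0 ≤ lev2C E₁ C₁ (p 0) (p 1) (p 2) (famGet famP11 i) ν)
    (hval2 : ∀ i ν, 0 ≤ lev2C E₂ C₂ (p 0) (p 1) (p 3) (famGet famP11 i) ν) (μ : ℕ) :
    0 ≤ lev2C (plainSet p cornerPSkel ∪ E₁ ∪ E₂) (C₁ ∪ C₂) (p 0) (p 2) (p 3) (mirror2 starXTab) μ :=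
  shape2C_nonneg_of_rows hinj hE1 hE2 hp1 hp2 h12 hm1 hm2 (hinj.ne (by decide)) (hinj.ne (by decide)) rfl rfl rfl rfl rfl rfl
    (by decide) (by decide) rfl rfl rfl cornerPSkel_ne cornerPSkel_nodup cornerPSkel_marks hd1 hd2 (mirror2 starXTab) (by norm_num)
    cornerP_starXm_rows (Prod2.ofIdx_nonneg (famGet_famP11orb_nonneg hval1) (famGet_famP11orb_nonneg hval2)) μ

end CornerLeaf

end FK

end Summit.CriticalPhenomena.PercolationContinuityZ3.Theorems
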